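import Summits.Ventures.HodgeRepro.Tier4.Common.SL2BallGrowth

/-!
# Tier4/Common/SL2BallTransport — the ball growth of `SL(2, ℝ)` transported along `K × SL(2, ℝ) →* H`

Blind re-derivation cell `pub-hodge-repro`, Tier 4 (README §9–§10), seat t4-typer-2 (gen 5).  Target tree path
`lean/Summits/Ventures/HodgeRepro/Tier4/Common/SL2BallTransport.lean`; imports Mathlib + `Common.SL2BallGrowth`
(+ `SL2BallFubini`, `SL2ConeMeasure`).  STAGE B of C-COMMON-SL2BALL (bus S15425 / S15491; plan-4 g5's plate line S15469):

**`haar_logSublevel_le_exp_of_hom`** — `K` a compact group, `H` a locally compact second countable group (Borel),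
`ψ : K × SL(2, ℝ) →* H` continuous, surjective and proper (`Tendsto ψ (cocompact _) (cocompact H)`), `N : H → ℝ`
continuous with `c * l1 h ≤ N (ψ (k, h))` for some `c > 0`: then for EVERY Haar measure `μ` on `H` and every `ε > 0`
there is `C ≥ 0` with `μ {x | log (max 1 (N x)) ≤ T} ≤ ofReal (C * exp ((2 + ε) * T))` for all `T ≥ 0`.
Proof: `Measure.map ψ (μK.prod coneMeasure)` is a Haar measure on `H` (`isHaarMeasure_map`), so `μ` is a multiple of it
(`isMulLeftInvariant_eq_smul`); the preimage of the sublevel set lies in `univ ×ˢ ball (c' e^T)`, `c' = max 1 c⁻¹`, and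
`haar_ball_le_rpow` bounds the ball.  CONSUMER: stage C (line side, S15470) instantiates `K = U(1)`, `H` = the `w₀`-slice
of `infinitePart W`, `ψ (z, h) = z · C h C⁻¹` through `locMat` (Cayley), `N = archSizeAt w₀`; the conclusion is L4-p2's
`hslice` of `archBallGrowth_of_slice` with `α = 2 + ε < 3`.

Nothing here says anything about the status of the Hodge conjecture for CM abelian varieties, which is NOT proved
(HC_CM is NOT proved by anyone in this repository).
-/

set_option autoImplicit false

noncomputable section

open MeasureTheory Measure Set Function Topology
open scoped NNReal ENNReal Pointwise MatrixGroups

namespace Summit.Ventures.HodgeRepro.Tier4.Common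

namespace SL2Ball

/-! ## 8. Transport along a continuous surjective proper homomorphism `K × SL(2, ℝ) →* H` -/

section Transport

variable [MeasurableSpace SL(2, ℝ)] [BorelSpace SL(2, ℝ)]
variable {K : Type*} [Group K] [TopologicalSpace K] [IsTopologicalGroup K] [CompactSpace K]
  [MeasurableSpace K] [BorelSpace K]
variable {H : Type*} [Group H] [TopologicalSpace H] [IsTopologicalGroup H] [LocallyCompactSpace H]
  [SecondCountableTopology H] [MeasurableSpace H] [BorelSpace H]

/-- **Transport of the ball growth** (stage B of C-COMMON-SL2BALL): if `ψ : K × SL(2, ℝ) →* H` is a continuous surjective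
proper homomorphism with `K` compact, and `N : H → ℝ` dominates `c · l1` through `ψ` (`c * l1 h ≤ N (ψ (k, h))`, `c > 0`),
then for EVERY Haar measure `μ` on `H` and every `ε > 0` there is `C ≥ 0` with
`μ {x | log (max 1 (N x)) ≤ T} ≤ C e^((2+ε) T)` for all `T ≥ 0`.  Proof: `Measure.map ψ (μK.prod coneMeasure)` is a Haar
measure on `H` (`isHaarMeasure_map`), hence `μ` is a multiple of it (`isMulLeftInvariant_eq_smul`); the preimage of the
sublevel set lies in `univ ×ˢ ball (c' e^T)` with `c' = max 1 c⁻¹`, and `haar_ball_le_rpow` bounds the ball. -/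
theorem haar_logSublevel_le_exp_of_hom (μK : Measure K) [IsHaarMeasure μK]
    (ψ : K × SL(2, ℝ) →* H) (hψc : Continuous ψ) (hψs : Surjective ψ)
    (hψp : Filter.Tendsto ψ (Filter.cocompact (K × SL(2, ℝ))) (Filter.cocompact H))
    (N : H → ℝ) (hN : Continuous N) {c : ℝ} (hc : 0 < c) (hcmp : ∀ k h, c * l1 h ≤ N (ψ (k, h)))
    (μ : Measure H) [IsHaarMeasure μ] {ε : ℝ} (hε : 0 < ε) :
    ∃ C : ℝ, 0 ≤ C ∧ ∀ T : ℝ, 0 ≤ T →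
      μ {x | Real.log (max 1 (N x)) ≤ T} ≤ ENNReal.ofReal (C * Real.exp ((2 + ε) * T)) := by
  haveI := locallyCompactSpace_SL2
  haveI := secondCountableTopology_SL2
  haveI := isHaarMeasure_coneMeasure
  set μ₀ : Measure H := Measure.map ψ (μK.prod coneMeasure) with hμ₀
  haveI : IsHaarMeasure μ₀ := isHaarMeasure_map (μK.prod coneMeasure) ψ hψc hψs hψp
  obtain ⟨C, hC, hball⟩ := haar_ball_le_rpow coneMeasure hε
  set c₀ : ℝ≥0 := haarScalarFactor μ μ₀ with hc₀
  have hμ : μ = c₀ • μ₀ := isMulLeftInvariant_eq_smul μ μ₀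
  set c' : ℝ := max 1 c⁻¹ with hc'
  have hc'1 : 1 ≤ c' := le_max_left _ _
  have hc'0 : 0 ≤ c' := zero_le_one.trans hc'1
  have hKfin : μK univ ≠ ⊤ := measure_ne_top μK univ
  refine ⟨(c₀ : ℝ) * (μK univ).toReal * (C * c' ^ (2 + ε)), by positivity, fun T hT => ?_⟩
  have hS : MeasurableSet {x : H | Real.log (max 1 (N x)) ≤ T} :=
    measurableSet_le (Real.measurable_log.comp (continuous_const.max hN).measurable) measurable_const
  have hR1 : 1 ≤ c' * Real.exp T := by
    calc (1 : ℝ) = 1 * 1 := (mul_one 1).symm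
      _ ≤ c' * Real.exp T := mul_le_mul hc'1 (Real.one_le_exp hT) zero_le_one hc'0
  have hsub : ψ ⁻¹' {x : H | Real.log (max 1 (N x)) ≤ T} ⊆ (univ : Set K) ×ˢ ball (c' * Real.exp T) := by
    rintro ⟨k, h⟩ hkh
    simp only [mem_preimage, mem_setOf_eq] at hkh
    refine ⟨mem_univ _, ?_⟩
    show l1 h ≤ c' * Real.exp T
    have h1 : (0 : ℝ) < max 1 (N (ψ (k, h))) := lt_of_lt_of_le one_pos (le_max_left _ _)
    have hmax : max 1 (N (ψ (k, h))) ≤ Real.exp T := by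
      rw [← Real.exp_log h1]
      exact Real.exp_le_exp.2 hkh
    have hNle : N (ψ (k, h)) ≤ Real.exp T := le_trans (le_max_right _ _) hmax
    have hl : c * l1 h ≤ Real.exp T := (hcmp k h).trans hNle
    have hcinv : l1 h ≤ c⁻¹ * Real.exp T := by
      rw [← div_eq_inv_mul, le_div_iff₀ hc, mul_comm]
      exact hl
    exact hcinv.trans (mul_le_mul_of_nonneg_right (le_max_right _ _) (Real.exp_pos T).le)
  have hpow : (c' * Real.exp T) ^ (2 + ε) = c' ^ (2 + ε) * Real.exp ((2 + ε) * T) := by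
    rw [Real.mul_rpow hc'0 (Real.exp_pos T).le, ← Real.exp_mul, mul_comm T]
  calc μ {x : H | Real.log (max 1 (N x)) ≤ T}
      = (c₀ : ℝ≥0∞) * μ₀ {x : H | Real.log (max 1 (N x)) ≤ T} := by
        rw [hμ, Measure.smul_apply, ENNReal.smul_def, smul_eq_mul]
    _ = (c₀ : ℝ≥0∞) * (μK.prod coneMeasure) (ψ ⁻¹' {x : H | Real.log (max 1 (N x)) ≤ T}) := by
        rw [hμ₀, Measure.map_apply hψc.measurable hS]
    _ ≤ (c₀ : ℝ≥0∞) * (μK.prod coneMeasure) ((univ : Set K) ×ˢ ball (c' * Real.exp T)) :=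
        mul_le_mul_right (measure_mono hsub) _
    _ = (c₀ : ℝ≥0∞) * (μK univ * coneMeasure (ball (c' * Real.exp T))) := by rw [Measure.prod_prod]
    _ ≤ (c₀ : ℝ≥0∞) * (μK univ * ENNReal.ofReal (C * (c' * Real.exp T) ^ (2 + ε))) :=
        mul_le_mul_right (mul_le_mul_right (hball _ hR1) _) _
    _ = ENNReal.ofReal ((c₀ : ℝ) * (μK univ).toReal * (C * c' ^ (2 + ε)) * Real.exp ((2 + ε) * T)) := by
        have hK : μK univ = ENNReal.ofReal (μK univ).toReal := (ENNReal.ofReal_toReal hKfin).symm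
        conv_lhs => rw [hK]
        rw [← ENNReal.ofReal_coe_nnreal, ← ENNReal.ofReal_mul (by positivity),
          ← ENNReal.ofReal_mul (by positivity), hpow]
        congr 1
        ring

end Transport

end SL2Ball

end Summit.Ventures.HodgeRepro.Tier4.Common
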